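import Literature.Barriers.SmoothPoincare4.ExoticOpenFourSpaceEndPeriodicMetricProofs
import HarnessLib

/-!
# `deMichelisFreedman1992_continuum`: Taubes' height function `τ` is smooth (§2, p. 223)

Proof file (theorems only; sibling of `ExoticOpenFourSpaceEndPeriodicMetricProofs`) in the cone
of the named fact `Literature.Barriers.SmoothPoincare4.deMichelisFreedman1992_continuum`
(DeMichelis–Freedman 1992, Thm. 4.1 with Cor. 4.1).

§2 (p. 223): "To do elliptic analysis on `M_n`, Taubes [24] suggests introducing a proper
function `τ : M_∞ → ℝ₊` such that `τ(d(x)) = 1 + τ(x)` for all `x ∈ R⁴_1`. A section `s` of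
any Riemannian or Hermitian bundle with connection `∇` over `M` can be measured according to
the norms `‖s‖_{L^p_{k,δ}} = (∫_{M_∞} e^{τδ} Σ_{j ≤ k} |∇^j s|^p)^{1/p}`." The tree's
`EndPeriodic.exists_height_function` (`ExoticOpenFourSpaceEndPeriodicProofs`) produces such a
`τ` on the end of an open self-embedding of a locally compact space, CONTINUOUS off the end
compactum. For the analysis the weight `e^{τδ}` must be smooth; THIS FILE proves, in the smooth
setting of `EndPeriodicData` (`σ = incl ∘ φ⁻¹ : U → U`, `φ : V ≅ U` a diffeomorphism of open
subsets of a finite-dimensional `E`), that `τ` can be taken `C^∞` off the end compactum: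

* `isLocalDiffeomorph_inclusion` — the inclusion of open submanifolds `U ≤ V` is a `C^∞` local
  diffeomorphism; `EndPeriodicData.isLocalDiffeomorph_σ`, `isLocalDiffeomorph_iterate_σ` — so
  are `σ` and its iterates;
* `contMDiff_extend_zero_of_isLocalDiffeomorph` — the push-forward, extended by zero, of a
  compactly supported `C^∞` function along an injective `C^∞` local diffeomorphism is `C^∞`;
* `EndPeriodicData.exists_smooth_height_function` — **a `C^∞` Taubes height function**:
  `τ : U → ℝ`, `τ ≥ 0`, `C^∞` on `U ∖ ⋂ₖ σ^[k](U)`, `τ (σ x) = τ x + 1` there, `k ≤ τ` on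
  `σ^[k](U)` and `τ ≤ k` off `σ^[k](U)` (the construction of `exists_height_function` — a locally
  finite sum of push-forwards of a bump `ρ = 1` on `C` — run with a smooth bump).

Not formalized: the weighted Sobolev spaces `L^p_{k,δ}` and Taubes' Fredholm theory
([24], Prop. 4.2), i.e. the analysis of Thm. 2.1. No definitions, no named facts (D-0026).

## References

* S. DeMichelis, M. H. Freedman, *Uncountably many exotic `R⁴`'s in standard 4-space*,
  J. Differential Geom. 35 (1992) 219–254, §2 (p. 223) [DeMichelisFreedman1992].
* C. H. Taubes, *Gauge theory on asymptotically periodic 4-manifolds*, J. Differential Geom. 25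
  (1987) 363–430, §1 (the function `τ`), Prop. 4.2 [Taubes1987].

[DeMichelisFreedman1992]
-/

noncomputable section

open scoped Manifold ContDiff Topology
open TopologicalSpace Set Function Filter Topology

namespace Literature.Barriers.SmoothPoincare4

namespace EndPeriodic

/-! #### Inclusions of open submanifolds are local diffeomorphisms; push-forwards of bumps -/

section LocalDiffeo

variable {E : Type*} [NormedAddCommGroup E] [NormedSpace ℝ E] {H : Type*} [TopologicalSpace H]
  {I : ModelWithCorners ℝ E H} {M : Type*} [TopologicalSpace M] [ChartedSpace H M]
  {E' : Type*} [NormedAddCommGroup E'] [NormedSpace ℝ E'] {H' : Type*} [TopologicalSpace H']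
  {J : ModelWithCorners ℝ E' H'} {N : Type*} [TopologicalSpace N] [ChartedSpace H' N]

/-- **The inclusion of open submanifolds `U ≤ V` is a `C^∞` local diffeomorphism** (at `x` it
is the partial diffeomorphism `U ≅ {v ∈ V | ↑v ∈ U}` whose inverse is the identity on points).
[folklore] -/
theorem isLocalDiffeomorph_inclusion {U V : Opens M} (hUV : U ≤ V) :
    IsLocalDiffeomorph I I ∞ (Opens.inclusion hUV) := by
  classical
  intro x
  -- the inverse on `{v ∈ V | ↑v ∈ U}`, junk elsewhere
  set inv : V → U := fun v => if h : (v : M) ∈ U then ⟨v, h⟩ else x with hinv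
  have hinv_val : ∀ v : V, (v : M) ∈ U → ((inv v : U) : M) = v := fun v hv => by
    simp only [hinv, dif_pos hv]
  have htarget : IsOpen {v : V | (v : M) ∈ U} := U.2.preimage continuous_subtype_val
  refine ⟨{ toFun := Opens.inclusion hUV
            invFun := inv
            source := univ
            target := {v : V | (v : M) ∈ U}
            map_source' := fun u _ => u.2
            map_target' := fun _ _ => mem_univ _
            left_inv' := fun u _ => Subtype.ext (hinv_val _ u.2)
            right_inv' := fun v hv => Subtype.ext (hinv_val v hv)
            open_source := isOpen_univ
            open_target := htarget
            contMDiffOn_toFun := (contMDiff_inclusion hUV).contMDiffOn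
            contMDiffOn_invFun := ?_ }, mem_univ _, fun _ _ => rfl⟩
  intro v₀ hv₀
  refine ContMDiffAt.contMDiffWithinAt ?_
  rw [← ContMDiffAt.subtypeVal_comp_iff]
  have hev : Subtype.val ∘ inv =ᶠ[𝓝 v₀] (Subtype.val : V → M) := by
    filter_upwards [htarget.mem_nhds hv₀] with v hv
    exact hinv_val v hv
  exact contMDiff_subtype_val.contMDiffAt.congr_of_eventuallyEq hev

/-- **The push-forward of a compactly supported `C^∞` function along an injective `C^∞` local
diffeomorphism, extended by zero, is `C^∞`**: near a point `f a` of the image it is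
`ρ ∘ (local inverse of f)`, and off the (compact, closed) image of the support it vanishes
near every point outside the image. [folklore] -/
theorem contMDiff_extend_zero_of_isLocalDiffeomorph [T2Space N] {f : M → N}
    (hf : IsLocalDiffeomorph I J ∞ f) (hinj : Injective f) {ρ : M → ℝ}
    (hρ : ContMDiff I 𝓘(ℝ) ∞ ρ) (hρc : HasCompactSupport ρ) :
    ContMDiff J 𝓘(ℝ) ∞ (Function.extend f ρ 0) := by
  intro x
  by_cases hx : x ∈ range f
  · obtain ⟨a, rfl⟩ := hx
    have h1 : Function.extend f ρ 0 =ᶠ[𝓝 (f a)] ρ ∘ (hf a).localInverse := by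
      filter_upwards [(hf a).localInverse.open_source.mem_nhds (hf a).localInverse_mem_source]
        with z hz
      have hz' : f ((hf a).localInverse z) = z := (hf a).localInverse_right_inv hz
      rw [Function.comp_apply]
      conv_lhs => rw [← hz']
      exact hinj.extend_apply _ _ _
    exact ((hρ _).comp (f a) (hf a).localInverse_contMDiffAt).congr_of_eventuallyEq h1
  · have hK : IsCompact (f '' tsupport ρ) := hρc.image hf.contMDiff.continuous
    have hxK : x ∉ f '' tsupport ρ := fun ⟨a, _, ha⟩ => hx ⟨a, ha⟩
    have hev : Function.extend f ρ 0 =ᶠ[𝓝 x] fun _ => (0 : ℝ) := by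
      filter_upwards [hK.isClosed.isOpen_compl.mem_nhds hxK] with z hz
      by_cases hz' : ∃ a, f a = z
      · obtain ⟨a, rfl⟩ := hz'
        rw [hinj.extend_apply]
        exact image_eq_zero_of_notMem_tsupport fun ha => hz ⟨a, ha, rfl⟩
      · rw [Function.extend_apply' _ _ _ hz']
        rfl
    exact contMDiffAt_const.congr_of_eventuallyEq hev

end LocalDiffeo

end EndPeriodic

namespace EndPeriodicData

open EndPeriodic

variable {E : Type*} [NormedAddCommGroup E] [NormedSpace ℝ E] (D : EndPeriodicData E)

/-- `σ = incl ∘ φ⁻¹` is a `C^∞` local diffeomorphism of `U` (indeed a diffeomorphism onto the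
open subset `V`). [cite: DeMichelisFreedman1992, §2 (pp. 222–223)] -/
theorem isLocalDiffeomorph_σ : IsLocalDiffeomorph 𝓘(ℝ, E) 𝓘(ℝ, E) ∞ D.σ := fun x =>
  (D.φ.symm.isLocalDiffeomorph x).comp (K := 𝓘(ℝ, E)) (P := D.U)
    (isLocalDiffeomorph_inclusion D.hVU _)

/-- The iterates `σ^[k]` are `C^∞` local diffeomorphisms. [folklore] -/
theorem isLocalDiffeomorph_iterate_σ (k : ℕ) : IsLocalDiffeomorph 𝓘(ℝ, E) 𝓘(ℝ, E) ∞ (D.σ^[k]) := by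
  induction k with
  | zero =>
    rw [Function.iterate_zero]
    exact (Diffeomorph.refl 𝓘(ℝ, E) D.U ∞).isLocalDiffeomorph
  | succ k ih =>
    rw [Function.iterate_succ]
    exact fun x => (D.isLocalDiffeomorph_σ x).comp (K := 𝓘(ℝ, E)) (P := D.U) (ih _)

variable [FiniteDimensional ℝ E]

/-- **A `C^∞` Taubes height function** ("a proper function `τ : M_∞ → ℝ₊` such that
`τ(d(x)) = 1 + τ(x)`", §2, p. 223), on the end of `σ = incl ∘ φ⁻¹ : U → U`: there is
`τ : U → ℝ`, `τ ≥ 0`, which is `C^∞` on the complement of the end compactum `⋂ₖ σ^[k](U)`,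
satisfies `τ (σ x) = τ x + 1` there, `τ ≥ k` on `σ^[k](U)` minus the end compactum and `τ ≤ k`
off `σ^[k](U)` (`k ≤ τ ≤ k + 1` on the `k`-th ring, `τ → ∞` exactly towards the end
compactum). This is the construction of `EndPeriodic.exists_height_function` — `τ = Σₖ ρₖ`,
`ρₖ` the push-forward along `σ^[k]`, extended by zero, of a compactly supported bump `ρ = 1` on
`C` — run with a SMOOTH bump (`exists_contMDiffMap_one_nhds_of_subset_interior`); the
push-forwards are smooth (`contMDiff_extend_zero_of_isLocalDiffeomorph`) and the sum is locally
finite off the end compactum. (Properness holds towards the end; in the source `M_∞` is the end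
glued to a compact piece.) [cite: DeMichelisFreedman1992, §2 (p. 223)] -/
theorem exists_smooth_height_function :
    ∃ τ : D.U → ℝ, ContMDiffOn 𝓘(ℝ, E) 𝓘(ℝ) ∞ τ (⋂ k, range (D.σ^[k]))ᶜ ∧ (∀ x, 0 ≤ τ x) ∧
      (∀ x, x ∉ (⋂ k, range (D.σ^[k])) → τ (D.σ x) = τ x + 1) ∧
      (∀ (k : ℕ) (x : D.U), x ∉ (⋂ k, range (D.σ^[k])) → x ∈ range (D.σ^[k]) →
        (k : ℝ) ≤ τ x) ∧
      (∀ (k : ℕ) (x : D.U), x ∉ range (D.σ^[k]) → τ x ≤ k) := by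
  classical
  -- a smooth compactly supported bump `ρ = 1` on `C`
  obtain ⟨C', hC', hCC'⟩ := exists_compact_superset D.hC
  obtain ⟨ρ, hρ1, hρ0, hρ01⟩ := exists_contMDiffMap_one_nhds_of_subset_interior 𝓘(ℝ, E)
    (n := ⊤) D.hC.isClosed hCC'
  have hρ1' : ∀ x ∈ D.C, ρ x = 1 := fun x hx => hρ1.self_of_nhdsSet x hx
  have hρc : HasCompactSupport ρ := HasCompactSupport.intro hC' hρ0
  have hσ : IsOpenEmbedding D.σ := D.isOpenEmbedding_σ
  have hσC : range D.σ ⊆ D.C := D.hσC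
  have hinj : ∀ k, Injective (D.σ^[k]) := fun k => hσ.injective.iterate k
  -- the push-forwards `ρ_k` of `ρ` along the iterates, extended by zero
  obtain ⟨ρk, hρk_def⟩ : ∃ ρk : ℕ → D.U → ℝ, ∀ k, ρk k = Function.extend (D.σ^[k]) ρ 0 :=
    ⟨_, fun _ => rfl⟩
  have hρk_apply : ∀ k a, ρk k (D.σ^[k] a) = ρ a := fun k a => by
    rw [hρk_def]
    exact (hinj k).extend_apply _ _ a
  have hρk_zero : ∀ k x, x ∉ range (D.σ^[k]) → ρk k x = 0 := fun k x hx => by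
    rw [hρk_def, Function.extend_apply' _ _ _ (by simpa only [mem_range] using hx)]
    rfl
  have hρk_mem : ∀ k x, ρk k x ∈ Icc (0 : ℝ) 1 := fun k x => by
    by_cases hx : x ∈ range (D.σ^[k])
    · obtain ⟨a, rfl⟩ := hx
      rw [hρk_apply]
      exact hρ01 a
    · rw [hρk_zero k x hx]
      exact ⟨le_rfl, zero_le_one⟩
  have hρk_smooth : ∀ k, ContMDiff 𝓘(ℝ, E) 𝓘(ℝ) ∞ (ρk k) := fun k => by
    rw [hρk_def]
    exact contMDiff_extend_zero_of_isLocalDiffeomorph (D.isLocalDiffeomorph_iterate_σ k) (hinj k)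
      ρ.contMDiff hρc
  have hρk_succ : ∀ k x, ρk (k + 1) (D.σ x) = ρk k x := fun k x => by
    by_cases hx : x ∈ range (D.σ^[k])
    · obtain ⟨a, rfl⟩ := hx
      rw [hρk_apply, ← Function.iterate_succ_apply' D.σ k a, hρk_apply]
    · rw [hρk_zero k x hx, hρk_zero]
      rintro ⟨a, ha⟩
      rw [Function.iterate_succ_apply'] at ha
      exact hx ⟨a, hσ.injective ha⟩
  have hρk_zero_apply : ∀ x, ρk 0 (D.σ x) = 1 := fun x => by
    have := hρk_apply 0 (D.σ x)
    rw [Function.iterate_zero_apply] at this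
    rw [this]
    exact hρ1' _ (hσC ⟨x, rfl⟩)
  -- off the end compactum only finitely many `ρ_k` are nonzero, locally uniformly
  have hvanish : ∀ (m k : ℕ) (z : D.U), z ∉ D.σ^[m] '' D.C → m < k → ρk k z = 0 := by
    intro m k z hz hmk
    apply hρk_zero
    obtain ⟨j, rfl⟩ := Nat.exists_eq_add_of_lt hmk
    intro hz'
    have h1 : z ∈ D.σ^[m + j] '' D.C := range_iterate_succ_subset_image hσC (m + j) hz'
    exact hz (antitone_image_iterate hσC (Nat.le_add_right m j) h1)
  have hfin : ∀ x : D.U, x ∉ (⋂ k, range (D.σ^[k])) → ∃ m, x ∉ D.σ^[m] '' D.C := fun x hx => by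
    rw [iInter_range_iterate_eq hσC] at hx
    simpa only [mem_iInter, not_forall] using hx
  have hsum_eq : ∀ (m : ℕ) (z : D.U), z ∉ D.σ^[m] '' D.C →
      ∑' k, ρk k z = ∑ k ∈ Finset.range (m + 1), ρk k z := fun m z hz =>
    tsum_eq_sum fun k hk => hvanish m k z hz (by simpa [Finset.mem_range, not_lt,
      Nat.succ_le_iff] using hk)
  obtain ⟨τ, hτ_def⟩ : ∃ τ : D.U → ℝ, ∀ x, τ x = ∑' k, ρk k x := ⟨_, fun _ => rfl⟩
  have hτ_nonneg : ∀ x, 0 ≤ τ x := fun x => by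
    rw [hτ_def]
    exact tsum_nonneg fun k => (hρk_mem k x).1
  have hsmooth : ContMDiffOn 𝓘(ℝ, E) 𝓘(ℝ) ∞ τ (⋂ k, range (D.σ^[k]))ᶜ := by
    intro x hx
    obtain ⟨m, hm⟩ := hfin x hx
    have hU : (D.σ^[m] '' D.C)ᶜ ∈ 𝓝 x :=
      (D.hC.image (hσ.continuous.iterate m)).isClosed.isOpen_compl.mem_nhds hm
    have hev : τ =ᶠ[𝓝 x] fun z => ∑ k ∈ Finset.range (m + 1), ρk k z := by
      filter_upwards [hU] with z hz
      rw [hτ_def]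
      exact hsum_eq m z hz
    refine (ContMDiffAt.congr_of_eventuallyEq ?_ hev).contMDiffWithinAt
    exact ContMDiffAt.sum fun k _ => hρk_smooth k x
  have hshift : ∀ x, x ∉ (⋂ k, range (D.σ^[k])) → τ (D.σ x) = τ x + 1 := by
    intro x hx
    obtain ⟨m, hm⟩ := hfin x hx
    have hs : Summable fun k => ρk (k + 1) (D.σ x) := by
      simp_rw [hρk_succ]
      exact summable_of_ne_finset_zero (s := Finset.range (m + 1)) fun k hk =>
        hvanish m k x hm (by simpa [Finset.mem_range, not_lt, Nat.succ_le_iff] using hk)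
    rw [hτ_def, hτ_def, tsum_eq_zero_add' (f := fun k => ρk k (D.σ x)) hs]
    simp_rw [hρk_succ, hρk_zero_apply]
    ring
  have hlower : ∀ (k : ℕ) (x : D.U), x ∉ (⋂ k, range (D.σ^[k])) → x ∈ range (D.σ^[k]) →
      (k : ℝ) ≤ τ x := by
    intro k
    induction k with
    | zero =>
      intro x _ _
      exact_mod_cast hτ_nonneg x
    | succ k ih =>
      rintro x hx ⟨y, rfl⟩
      rw [Function.iterate_succ_apply'] at hx ⊢
      have hy : D.σ^[k] y ∉ ⋂ k, range (D.σ^[k]) := fun h =>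
        hx ((apply_mem_iInter_range_iterate_iff hσ.injective).2 h)
      rw [hshift _ hy]
      push_cast
      linarith [ih (D.σ^[k] y) hy ⟨y, rfl⟩]
  have hupper : ∀ (k : ℕ) (x : D.U), x ∉ range (D.σ^[k]) → τ x ≤ k := by
    intro k x hx
    have h0 : ∀ j, j ∉ Finset.range k → ρk j x = 0 := fun j hj =>
      hρk_zero j x fun h => hx (antitone_range_iterate D.σ
        (by simpa [Finset.mem_range, not_lt] using hj) h)
    rw [hτ_def, tsum_eq_sum h0]
    calc ∑ j ∈ Finset.range k, ρk j x ≤ ∑ _j ∈ Finset.range k, (1 : ℝ) :=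
          Finset.sum_le_sum fun j _ => (hρk_mem j x).2
      _ = k := by simp
  exact ⟨τ, hsmooth, hτ_nonneg, hshift, hlower, hupper⟩

/-- In particular the weight `e^{δ τ}` of the norms `L^p_{k,δ}` of §2 is `C^∞` on the end.
[cite: DeMichelisFreedman1992, §2 (p. 223)] -/
theorem exists_smooth_weight (δ : ℝ) :
    ∃ τ : D.U → ℝ, ContMDiffOn 𝓘(ℝ, E) 𝓘(ℝ) ∞ (fun x => Real.exp (δ * τ x)) (⋂ k, range (D.σ^[k]))ᶜ ∧
      (∀ x, x ∉ (⋂ k, range (D.σ^[k])) →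
        Real.exp (δ * τ (D.σ x)) = Real.exp δ * Real.exp (δ * τ x)) := by
  obtain ⟨τ, hτ, -, hshift, -, -⟩ := D.exists_smooth_height_function
  refine ⟨τ, ?_, fun x hx => ?_⟩
  · have hg : ContMDiff 𝓘(ℝ) 𝓘(ℝ) ∞ fun r : ℝ => Real.exp (δ * r) :=
      (Real.contDiff_exp.comp (contDiff_const.mul contDiff_id)).contMDiff
    exact hg.comp_contMDiffOn hτ
  · rw [hshift x hx, mul_add, mul_one, Real.exp_add, mul_comm]

end EndPeriodicData

end Literature.Barriers.SmoothPoincare4
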